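import Summits.QuantumFields.BalabanUV.Beta.FP.NestedStepLawTorusTransportedGraded
import Summits.QuantumFields.BalabanUV.Beta.FP.NestedStepLawTorusInstanceRows
import Summits.QuantumFields.BalabanUV.Beta.FP.PeriodisedCompositeIndexWard
import Summits.QuantumFields.BalabanUV.Beta.FP.TorusGeneratorIntertwining

/-!
# `BalabanUV.Beta.FP.NestedStepLawTorusTransportedRowsGraded` — road «FP» for binder row D1, ROUTE T, presentation T-β, option (δ) «LIFT ∕ GRADED» (R-FP-54′):
# **THE OWNER's GRADED TORUS CALL, TRANSPORT FIRST (`NestedStepLawTorusTransportedGraded`), WITH leaf-02's ONE-SIDED ROWS `a0 c1 d1 t1 q1` AND THE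
# INTERTWINING LETTER `j1` DISCHARGED BY TERM** — the graded twin of `NestedStepLawTorusTransportedRows` (p321180) ∕ `…RowsJ1` (p321955)

WHAT.  The OWNER d1-p3 g19's `NestedStepLawTorusTransportedGraded.secondVar_oneShot_nestedStepLaw_torus_transported_graded` is the (B) torus call p320614
read through the GRADED (colour-stripped) door (`NestedStepLawOneShotJetsGraded` p323821 → `NestedStepLawTransportedGraded` → `…TransportedExpGraded`):
the congruence words `k1 k2` and the Ward rows `a1 a2` GRADED (sign `(−1)^{#transposed odd objects}`), NO transposed rows `a*t`, the parities
`H₁ᵀ = −H₁ ∕ H₂ᵀ = H₂` displayed, the one-shot dead rows `p1 p2` replaced by the (UNI)-jet letter `uP'`, the odd bordered jets (−)-PLACED in the conclusion.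
Under R-FP-54′ the graded door consumes leaf-02's one-sided rows UN-LIFTED: every row this lineage discharges (`a0` order-0 Ward, `c1` insertion-table
covariance, `d1` coarse covariance, `t1` nested dead row, `q1` composite insertion jet along `h + Dλ`) and leaf-06's `j1` are ONE-SIDED letters whose
spellings in the graded call are p320614's VERBATIM — so they are supplied by the SAME terms as in p321180 ∕ p321955:

* `a0` — `PeriodisedWardOrderZero.torus_a0_letter` (p317178) at `Y₀ := 0` (the graded `a1 a2` then read `… = 𝔔₀ᵀY₁`, `… = −2•𝔔₁ᵀY₁ + 𝔔₀ᵀY₂`; `a0t` is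
  gone — `H₀ᵀ = H₀` is discharged INSIDE the graded call by this lineage's `torus_H₀_transpose`);
* `c1` — `PeriodisedBorderWardContactInstance.torus_c1_vhSAt_weighted` (p314580), the fine insertion-table family `hQ₁₁` along `h`;
* `d1` — `PeriodisedCoarseWardContact.torus_d1_vhSAt_weighted` (p317562), the coarse family `hQ₂₁` transported by `θ_j·Q₁₀`;
* `t1` — `NestedStepLawTorusInstanceRows.torus_t1_of_average_dead` (p319828), hypothesis `hdead` displayed;
* `q1` — `PeriodisedCompositeIndexWard.torus_q1_letter` (p320102): the conjugated first composite averaging word IS the composite insertion jet along the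
  GAUGE-SHIFTED direction `h + Dλ` (`h𝔔'₁` NAMED; `X X̄` PINNED to the diagonal gauge generators of `λ`, `hX hXbar`);
* `j1` — leaf-06's `TorusGeneratorIntertwining.torus_j1` (p320573) after `weightedJet_eq`, with `W′₁ := W₁^{(h+Dλ)}` in closed form (`hW'₁`) and the
  parameter transport `c • C₁(λ)` (`hC₁` VERBATIM, `c = (Lc^{d+1}·stepScale_j)⁻¹`).

This file is ONE theorem **`secondVar_oneShot_nestedStepLaw_torus_transported_graded_rows`** = the graded call with those six binders REMOVED and the row
data bound by defining equations (`hQ₁₁ hQ₂₁ hW₁ hDb₁ hdead hX hXbar h𝔔'₁ hW'₁ hC₁`, all VERBATIM p321180 ∕ p321955).  Proof = `subst` + ONE TERM.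
[folklore] composition BY NAME; no `def`, no `def … : Prop`, nothing cited, 0 sorry.  Nothing of the dictionary asserted: the GRADING is the door's
(an3's sign convention of record, `mfNeg`); whether the literal's tables satisfy the displayed graded letters is the dictionary's ∕ OWNER's word.

What STAYS displayed: `k1 k2` (GRADED form words; at the record `X` diagonal, `k1` is the commutator word `H′₁ = H₁ + (H₀X − XH₀)`), `q2 j2` (order 2),
`uC`, `uP'` (leaf-06: dead big-comb rows ⟹ it by `secondVar_zero_jets`, or `TorusOneShotFPExponential.torus_uP_exp` for exponential generator jets),
the nested dead rows `s1 s2 t2`, the parities `hH₁t hH₂t` (level-0 producers: leaf-05 `torus_H1_transpose` ∕ `torus_H2_transpose_wsym22`), the graded Ward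
rows `a1 a2`, the covariance rows `c2 d2`, block namings.

HONEST DEPENDENCY (page 1, mandatory): continuum YM on T⁴ ⇐ BetaPertH ∧ nine spine estimates (0/9 proved); BetaPertH ⇐ (D1) ∧ (D4) ∧ CAP+tail;
G-an2-4 gates asym, D1 and NE2/3/4.  HONEST FRAMING (cell contract, verbatim): «discharging `BetaPertH` makes Bałaban's UV stability UNCONDITIONAL —
a real constructive-QFT result; it is NOT the continuum limit and NOT the Clay problem.»  ABSOLUTE RULE (cell charter, verbatim): «No internally-minted
statement may enter as a cited fact. Every hypothesis is either kernel-proved in this package or a verbatim quotation of a PUBLISHED theorem with page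
reference. The manuscript(s) under audit are NOT citable for their own disputed steps — they are the thing under adjudication; programme-internal
(2001/route/tribunal) claims are never citable.»  0 estimates; 0∕4 row-D1 binders; NOT (T-ID)∕(T-β) complete, NOT SDF, NOT D1, NOT BetaPertH, NOT
continuum, NOT Clay.  Road «FP», D1 formalisation swarm leaf-02 (b2b-balaban-beta-d1-formalise-leaf-02) gen 20, 2026-08-22 (OWNER d1-p3 g19 W-FP-19-4
«the graded ROWS are yours»).  No existing file touched.
-/

noncomputable section

open scoped BigOperators Matrix

namespace Summit.QuantumFields.BalabanUV.Beta.FP.NestedStepLawTorusTransportedRowsGraded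

open Matrix Finset
open Literature.Probability.LatticeModels (Torus.proj)
open Literature.MathematicalPhysics.QuantumFieldTheory.Balaban1983to89
open Literature.MathematicalPhysics.QuantumFieldTheory.Balaban1983to89.Beta
open Literature.MathematicalPhysics.QuantumFieldTheory.Balaban1983to89.Beta.Composition (kkt)
open Literature.MathematicalPhysics.QuantumFieldTheory.Balaban1983to89.Beta.CompositionSingular (effForm flucCov minOp minOpL)
open Literature.MathematicalPhysics.QuantumFieldTheory.LatticeForm (quo)
open B5Prop11Plancherel (fine)
open B6Lemma24Torus (pbox mem_pbox)
open AffineAveraging (Site box toSite unitVec)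
open AveragingHessianKernelsRooted (vhSAt)
open OneStepResolventKernel (Fib)
open Summit.QuantumFields.BalabanUV.Beta.BorderedHessian (bhKStepAt stepScale)
open Summit.QuantumFields.BalabanUV.Beta.D1BFx.LogDetSecondVariation (secondVar)
open Summit.QuantumFields.BalabanUV.Beta.FP.KernelPeriodisationFib (Idx perF)
open Summit.QuantumFields.BalabanUV.Beta.FP.KernelPeriodisationFibLoc (dper)
open Summit.QuantumFields.BalabanUV.Beta.FP.TorusGaugeCovariance (tdelta tgrad)
open Summit.QuantumFields.BalabanUV.Beta.FP.TorusGaugeCovarianceCoarse (coarsePt tgradBlock)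
open Summit.QuantumFields.BalabanUV.Beta.FP.TorusCombRows (Res combRowsT combBondT)
open Summit.QuantumFields.BalabanUV.Beta.FP.TorusCombNestedBasis (resBigEquiv)
open Summit.QuantumFields.BalabanUV.Beta.GAN24.FineReadoutCauchyFrame (toSite_mem_range)
open Summit.QuantumFields.BalabanUV.Beta.FP.NestedStepLawTorusTransportedGraded (secondVar_oneShot_nestedStepLaw_torus_transported_graded)
open Summit.QuantumFields.BalabanUV.Beta.FP.PeriodisedWardOrderZero (torus_a0_letter)
open Summit.QuantumFields.BalabanUV.Beta.FP.PeriodisedBorderWardContactInstance (torus_c1_vhSAt_weighted)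
open Summit.QuantumFields.BalabanUV.Beta.FP.PeriodisedCoarseWardContact (torus_d1_vhSAt_weighted)
open Summit.QuantumFields.BalabanUV.Beta.FP.NestedStepLawTorusInstanceRows (torus_t1_of_average_dead)
open Summit.QuantumFields.BalabanUV.Beta.FP.PeriodisedCompositeIndexWard (torus_q1_letter)
open Summit.QuantumFields.BalabanUV.Beta.FP.TorusGeneratorIntertwining (torus_j1 weightedJet_eq)

variable {d : ℕ} (M' : Fin (d + 1) → ℕ) [∀ μ, NeZero (M' μ)] {Lc : ℕ} [NeZero Lc] {r r' : Fin (d + 1) → ℕ}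

set_option synthInstance.maxSize 1024 in
/-- [folklore] **THE GRADED TORUS CALL, TRANSPORT FIRST (T-β, option (δ)), WITH leaf-02's ROWS AND leaf-06's `j1` DISCHARGED BY TERM.**
`NestedStepLawTorusTransportedGraded.secondVar_oneShot_nestedStepLaw_torus_transported_graded` (OWNER d1-p3 g19) with: the insertion-table families, the
generator jet and the coarse jet bound by defining equations along a direction `h` (`hQ₁₁ hQ₂₁ hW₁ hDb₁`); the transport generators `X X̄` PINNED to the
diagonal gauge generators of a parameter `λ` (`hX hXbar`); the one-shot literal's first composite averaging jet NAMED along the gauge-shifted direction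
`h + Dλ` (`h𝔔'₁`); the one-shot chart's generator first jet bound in closed form `hW'₁ : W′₁ = W₁^{(h+Dλ)}` and the parameter transport `c • C₁(λ)` (`hC₁`);
and the binders `a0 c1 d1 t1 q1 j1` REMOVED — supplied inside by `torus_a0_letter` (`Y₀ := 0`), `torus_c1_vhSAt_weighted`, `torus_d1_vhSAt_weighted`,
`torus_t1_of_average_dead` (`hdead` displayed), `torus_q1_letter`, `torus_j1 ∘ weightedJet_eq`.  Displayed, GRADED as the OWNER's call: `k1 k2`, `a1 a2`
(read at `Y₀ = 0`), `hH₁t hH₂t`, `uP'`; one-sided unchanged: `q2 j2 uC s1 s2 t2 c2 d2`.  Conclusion VERBATIM the graded call's: one-shot literal's sliced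
2-jet (odd bordered jet (−)-placed) `=` fine one-step sliced `+` coarse sliced (graded words), NO defect. -/
theorem secondVar_oneShot_nestedStepLaw_torus_transported_graded_rows (hr : r ∈ box (d + 1) Lc) (hr' : r' ∈ box (d + 1) Lc) (hM' : ∀ i, Lc ∣ M' i) (j : ℕ)
    {κ : Type*} [Fintype κ] [DecidableEq κ] (pμ' : κ → ↥(pbox M')) (mμ' : κ → Fin (d + 1))
    (hfμ' : Function.Injective (fun a : κ => ((pμ' a, Sum.inr (mμ' a)) : Idx M' (Fib d))))
    (hcoarse' : ∀ (s : ↥(pbox M')) (m : Fin (d + 1)),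
      ((s, Sum.inr m) : Idx M' (Fib d)) ∈ Set.range (fun a : κ => ((pμ' a, Sum.inr (mμ' a)) : Idx M' (Fib d))) ↔ Torus.proj Lc (s : Site (d + 1)) = 0)
    -- the torus objects of record, by defining equations
    {H₀ : Matrix (↥(pbox (fine Lc M')) × Fin (d + 1)) (↥(pbox (fine Lc M')) × Fin (d + 1)) ℝ}
    {Q₁₀ : Matrix (↥(pbox M') × Fin (d + 1)) (↥(pbox (fine Lc M')) × Fin (d + 1)) ℝ}
    {τ₁ : Matrix (Res (toSite r) Lc (fine Lc M')) (↥(pbox (fine Lc M')) × Fin (d + 1)) ℝ}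
    {τ₂ : Matrix (Res (toSite r') Lc M') (↥(pbox M') × Fin (d + 1)) ℝ}
    {D₁ : Matrix (↥(pbox (fine Lc M')) × Fin (d + 1)) (Res (toSite r) Lc (fine Lc M')) ℝ}
    {D₂ : Matrix (↥(pbox (fine Lc M')) × Fin (d + 1)) (Res (toSite r') Lc M') ℝ}
    {Dbar : Matrix (↥(pbox M') × Fin (d + 1)) (Res (toSite r') Lc M') ℝ}
    {P : Matrix (Res (toSite r') Lc M' ⊕ Res (toSite r) Lc (fine Lc M')) (↥(pbox (fine Lc M')) × Fin (d + 1)) ℝ}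
    (hH₀ : H₀ = (perF (fine Lc M') (bhKStepAt d (toSite r) Lc j)).submatrix
        (fun b : ↥(pbox (fine Lc M')) × Fin (d + 1) => ((b.1, Sum.inl b.2) : Idx (fine Lc M') (Fib d)))
        (fun b : ↥(pbox (fine Lc M')) × Fin (d + 1) => ((b.1, Sum.inl b.2) : Idx (fine Lc M') (Fib d))))
    (hQ₁₀ : Q₁₀ = (perF (fine Lc M') (bhKStepAt d (toSite r) Lc j)).submatrix
        (fun a : ↥(pbox M') × Fin (d + 1) => ((coarsePt M' Lc a.1, Sum.inr a.2) : Idx (fine Lc M') (Fib d)))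
        (fun b : ↥(pbox (fine Lc M')) × Fin (d + 1) => ((b.1, Sum.inl b.2) : Idx (fine Lc M') (Fib d))))
    (hτ₁ : τ₁ = (combRowsT (toSite r) Lc (fine Lc M')).submatrix id
        (fun b : ↥(pbox (fine Lc M')) × Fin (d + 1) => ((b.1, Sum.inl b.2) : Idx (fine Lc M') (Fib d))))
    (hτ₂ : τ₂ = (combRowsT (toSite r') Lc M').submatrix id (fun b : ↥(pbox M') × Fin (d + 1) => ((b.1, Sum.inl b.2) : Idx M' (Fib d))))
    (hD₁ : D₁ = (tgrad (fine Lc M')).submatrix (fun b : ↥(pbox (fine Lc M')) × Fin (d + 1) => ((b.1, Sum.inl b.2) : Idx (fine Lc M') (Fib d)))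
        (Subtype.val : Res (toSite r) Lc (fine Lc M') → ↥(pbox (fine Lc M'))))
    (hD₂ : D₂ = (tgradBlock M' Lc).submatrix (fun b : ↥(pbox (fine Lc M')) × Fin (d + 1) => ((b.1, Sum.inl b.2) : Idx (fine Lc M') (Fib d)))
        (Subtype.val : Res (toSite r') Lc M' → ↥(pbox M')))
    (hDbar : Dbar = Matrix.of fun (a : ↥(pbox M') × Fin (d + 1)) (t : Res (toSite r') Lc M') =>
        stepScale d Lc j * (((box (d + 1) Lc).card : ℝ) * tgrad M' (a.1, Sum.inl a.2) t.1))
    (hP : P = (combRowsT ((Lc : ℤ) • toSite r' + toSite r) (Lc * Lc) (fine Lc M')).submatrix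
        (resBigEquiv Lc Lc (toSite r) (toSite r') M' (Nat.pos_of_ne_zero (NeZero.ne Lc)) (toSite_mem_range hr)
          (Nat.pos_of_ne_zero (NeZero.ne Lc)) (toSite_mem_range hr')).symm
        (fun b : ↥(pbox (fine Lc M')) × Fin (d + 1) => ((b.1, Sum.inl b.2) : Idx (fine Lc M') (Fib d))))
    -- the displayed jets: form, averaging (both levels), block covariance, generators (fine and coarse), Ward witnesses
    (H₁ H₂ : Matrix (↥(pbox (fine Lc M')) × Fin (d + 1)) (↥(pbox (fine Lc M')) × Fin (d + 1)) ℝ)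
    {Q₂₀ : Matrix κ (↥(pbox M') × Fin (d + 1)) ℝ}
    (hQ₂₀ : Q₂₀ = (perF M' (bhKStepAt d (toSite r') Lc (j + 1))).submatrix (fun a : κ => ((pμ' a, Sum.inr (mμ' a)) : Idx M' (Fib d)))
        (fun b : ↥(pbox M') × Fin (d + 1) => ((b.1, Sum.inl b.2) : Idx M' (Fib d))))
    -- leaf-02's ORDER-1 ROWS ALONG A DIRECTION `h` AND THE GAUGE PARAMETER `λ` OF THE CHART TRANSPORT: the insertion-table families (fine, and coarse
    -- transported by `θ_j·Q₁₀`), the generator jet and the coarse jet by their defining equations (p314580, `PeriodisedCoarseWardContact`, `NestedStepLawTorusInstanceRows`)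
    (h : ↥(pbox (fine Lc M')) × Fin (d + 1) → ℝ) (lam : ↥(pbox (fine Lc M')) → ℝ)
    (Q₁₁ : (↥(pbox (fine Lc M')) × Fin (d + 1) → ℝ) → Matrix (↥(pbox M') × Fin (d + 1)) (↥(pbox (fine Lc M')) × Fin (d + 1)) ℝ)
    (hQ₁₁ : ∀ w, Q₁₁ w = ∑ b : ↥(pbox (fine Lc M')) × Fin (d + 1), w b •
        (perF (fine Lc M') (dper (fine Lc M') (vhSAt (toSite r) d Lc rfl b.2 (b.1 : Site (d + 1))))).submatrix
          (fun a : ↥(pbox M') × Fin (d + 1) => ((coarsePt M' Lc a.1, Sum.inr a.2) : Idx (fine Lc M') (Fib d)))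
          (fun b : ↥(pbox (fine Lc M')) × Fin (d + 1) => ((b.1, Sum.inl b.2) : Idx (fine Lc M') (Fib d))))
    (Q₂₁ : (↥(pbox (fine Lc M')) × Fin (d + 1) → ℝ) → Matrix κ (↥(pbox M') × Fin (d + 1)) ℝ)
    (hQ₂₁ : ∀ w, Q₂₁ w = ∑ b : ↥(pbox (fine Lc M')) × Fin (d + 1), w b •
        ∑ a' : ↥(pbox M') × Fin (d + 1), (stepScale d Lc (j + 1) / (stepScale d Lc j ^ 2 * ((box (d + 1) Lc).card : ℝ)) * Q₁₀ a' b) •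
          (perF M' (dper M' (vhSAt (toSite r') d Lc rfl a'.2 (a'.1 : Site (d + 1))))).submatrix (fun a : κ => ((pμ' a, Sum.inr (mμ' a)) : Idx M' (Fib d)))
            (fun b : ↥(pbox M') × Fin (d + 1) => ((b.1, Sum.inl b.2) : Idx M' (Fib d))))
    {W₁ : Matrix (↥(pbox (fine Lc M')) × Fin (d + 1)) (Res (toSite r') Lc M' ⊕ Res (toSite r) Lc (fine Lc M')) ℝ}
    (hW₁ : W₁ = ∑ b : ↥(pbox (fine Lc M')) × Fin (d + 1), h b •
        Matrix.of (fun (b' : ↥(pbox (fine Lc M')) × Fin (d + 1)) (e : Res (toSite r') Lc M' ⊕ Res (toSite r) Lc (fine Lc M')) =>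
          if b' = b then
            -((((Lc : ℝ) ^ (d + 1) * stepScale d Lc j)⁻¹)
              * Sum.elim (fun t : Res (toSite r') Lc M' => tdelta M' (quo Lc ((b.1 : Site (d + 1)) + unitVec b.2)) t.1)
                  (fun s : Res (toSite r) Lc (fine Lc M') => tdelta (fine Lc M') ((b.1 : Site (d + 1)) + unitVec b.2) s.1) e)
          else 0))
    {Db₁ : Matrix (↥(pbox M') × Fin (d + 1)) (Res (toSite r') Lc M') ℝ}
    (hDb₁ : Db₁ = ∑ b : ↥(pbox (fine Lc M')) × Fin (d + 1), h b •
        Matrix.of fun (a : ↥(pbox M') × Fin (d + 1)) (t : Res (toSite r') Lc M') =>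
          -((((Lc : ℝ) ^ (d + 1) * stepScale d Lc j)⁻¹) * Q₁₀ a b * tdelta M' ((a.1 : Site (d + 1)) + unitVec a.2) t.1))
    -- the NESTED chart's direction is average-coarse-comb-dead (the hypothesis of `torus_t1_of_average_dead`)
    (hdead : ∀ (a : ↥(pbox M') × Fin (d + 1)) (x : Res (toSite r') Lc M'),
      combBondT (toSite r') Lc M' x = ((a.1, Sum.inl a.2) : Idx M' (Fib d)) → ∑ b : ↥(pbox (fine Lc M')) × Fin (d + 1), Q₁₀ a b * h b = 0)
    -- the second-order data stay displayed
    (Q₁₂ : Matrix (↥(pbox M') × Fin (d + 1)) (↥(pbox (fine Lc M')) × Fin (d + 1)) ℝ) (Q₂₂ : Matrix κ (↥(pbox M') × Fin (d + 1)) ℝ)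
    (W₂ : Matrix (↥(pbox (fine Lc M')) × Fin (d + 1)) (Res (toSite r') Lc M' ⊕ Res (toSite r) Lc (fine Lc M')) ℝ)
    (Db₂ : Matrix (↥(pbox M') × Fin (d + 1)) (Res (toSite r') Lc M') ℝ)
    (Y₁ Y₂ : Matrix κ (Res (toSite r') Lc M' ⊕ Res (toSite r) Lc (fine Lc M')) ℝ)
    -- the chart transport (exponential currency): generators `X` (fields), `X̄` (composite multipliers); the one-shot chart's generator jets `W♯₁ W♯₂`;
    -- the parameter-transport jets `C₁ C₂`
    {X : Matrix (↥(pbox (fine Lc M')) × Fin (d + 1)) (↥(pbox (fine Lc M')) × Fin (d + 1)) ℝ} {Xbar : Matrix κ κ ℝ}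
    -- (T-β-1) at the torus: the transport generators ARE the diagonal gauge generators of the parameter `λ` (fields: `−c•E_λ`; composite multipliers: `c•R′_λ̄`)
    (hX : X = -((((Lc : ℝ) ^ (d + 1) * stepScale d Lc j)⁻¹) • Matrix.diagonal (fun b : ↥(pbox (fine Lc M')) × Fin (d + 1) => lam b.1)))
    (hXbar : Xbar = (((Lc : ℝ) ^ (d + 1) * stepScale d Lc j)⁻¹) •
        Matrix.diagonal (fun α : κ => ∑ t : ↥(pbox M'), tdelta M' ((pμ' α : Site (d + 1)) + toSite r') t
          * (∑ s : ↥(pbox (fine Lc M')), tdelta (fine Lc M') ((Lc : ℤ) • (t : Site (d + 1)) + toSite r) s * lam s)))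
    -- (T-β-4) AT THE TORUS (leaf-06 `TorusGeneratorIntertwining`): the one-shot chart's generator first jet IS the nested chart's generator jet ALONG THE
    -- GAUGE-SHIFTED DIRECTION `h + Dλ`, by its defining equation in closed form (`weightedJet_eq` currency)
    {W'₁ : Matrix (↥(pbox (fine Lc M')) × Fin (d + 1)) (Res (toSite r') Lc M' ⊕ Res (toSite r) Lc (fine Lc M')) ℝ}
    (hW'₁ : W'₁ = Matrix.of fun (b : ↥(pbox (fine Lc M')) × Fin (d + 1)) (e : Res (toSite r') Lc M' ⊕ Res (toSite r) Lc (fine Lc M')) =>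
        -((((Lc : ℝ) ^ (d + 1) * stepScale d Lc j)⁻¹) * (h b + ∑ s, tgrad (fine Lc M') (b.1, Sum.inl b.2) s * lam s)
          * Sum.elim (fun t : Res (toSite r') Lc M' => tdelta M' (quo Lc ((b.1 : Site (d + 1)) + unitVec b.2)) t.1)
            (fun s : Res (toSite r) Lc (fine Lc M') => tdelta (fine Lc M') ((b.1 : Site (d + 1)) + unitVec b.2) s.1) e))
    (W'₂ : Matrix (↥(pbox (fine Lc M')) × Fin (d + 1)) (Res (toSite r') Lc M' ⊕ Res (toSite r) Lc (fine Lc M')) ℝ)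
    -- the parameter-transport GENERATOR `C₁(λ)` by leaf-06's defining equation `hC₁` VERBATIM («multiplication by `λ` in the gauge-mode basis»: `diagonal λ̄`
    -- on the coarse residual parameters, `diagonal (λ∘val)` on the fine ones, coarse-to-fine block `(λ s − λ̄ t)·[block s = t]`); the transport is `c • C₁`
    {C₁ : Matrix (Res (toSite r') Lc M' ⊕ Res (toSite r) Lc (fine Lc M')) (Res (toSite r') Lc M' ⊕ Res (toSite r) Lc (fine Lc M')) ℝ}
    (hC₁ : C₁ = Matrix.fromBlocks
        (Matrix.diagonal fun t : Res (toSite r') Lc M' =>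
          ∑ s, tdelta (fine Lc M') ((Lc : ℤ) • ((t.1 : ↥(pbox M')) : Site (d + 1)) + toSite r) s * lam s)
        (0 : Matrix (Res (toSite r') Lc M') (Res (toSite r) Lc (fine Lc M')) ℝ)
        (Matrix.of fun (s : Res (toSite r) Lc (fine Lc M')) (t : Res (toSite r') Lc M') =>
          (lam s.1 - ∑ s', tdelta (fine Lc M') ((Lc : ℤ) • ((t.1 : ↥(pbox M')) : Site (d + 1)) + toSite r) s' * lam s')
            * tdelta M' (quo Lc ((s.1 : ↥(pbox (fine Lc M'))) : Site (d + 1))) t.1)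
        (Matrix.diagonal fun s : Res (toSite r) Lc (fine Lc M') => lam s.1))
    (C₂ : Matrix (Res (toSite r') Lc M' ⊕ Res (toSite r) Lc (fine Lc M')) (Res (toSite r') Lc M' ⊕ Res (toSite r) Lc (fine Lc M')) ℝ)
    {𝔔₀ 𝔔₁ 𝔔₂ : Matrix κ (↥(pbox (fine Lc M')) × Fin (d + 1)) ℝ}
    (h𝔔₀ : Q₂₀ * Q₁₀ = 𝔔₀) (h𝔔₁ : Q₂₁ h * Q₁₀ + Q₂₀ * Q₁₁ h = 𝔔₁)
    (h𝔔₂ : Q₂₂ * Q₁₀ + Q₂₁ h * Q₁₁ h + (Q₂₁ h * Q₁₁ h + Q₂₀ * Q₁₂) = 𝔔₂)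
    -- (T-β-1) GRADED: the ONE-SHOT literal's composite jets are the graded `X`-conjugated words of the nested-chart jets (`𝔎 = H`: δ-constrained), NAMED
    {H'₁ H'₂ : Matrix (↥(pbox (fine Lc M')) × Fin (d + 1)) (↥(pbox (fine Lc M')) × Fin (d + 1)) ℝ}
    {𝔔'₁ 𝔔'₂ : Matrix κ (↥(pbox (fine Lc M')) × Fin (d + 1)) ℝ}
    -- `q1` DISCHARGED (`PeriodisedCompositeIndexWard.torus_q1_letter`): the one-shot literal's first composite averaging jet IS the composite insertion jet
    -- along the GAUGE-SHIFTED direction `h + Dλ`, NAMED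
    (h𝔔'₁ : Q₂₁ (fun b => h b + ∑ s : ↥(pbox (fine Lc M')), tgrad (fine Lc M') (b.1, Sum.inl b.2) s * lam s) * Q₁₀
        + Q₂₀ * Q₁₁ (fun b => h b + ∑ s : ↥(pbox (fine Lc M')), tgrad (fine Lc M') (b.1, Sum.inl b.2) s * lam s) = 𝔔'₁)
    (k1 : -(Xᵀ * H₀) + H₁ + H₀ * X = H'₁)
    (k2 : (X * X)ᵀ * H₀ + (-(Xᵀ * H₁) + -(Xᵀ * H₀ * X)) + ((-(Xᵀ * H₁) + -(Xᵀ * H₀ * X)) + (H₂ + H₁ * X + (H₁ * X + H₀ * (X * X)))) = H'₂)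
    (q2 : Xbar * Xbar * 𝔔₀ + (Xbar * 𝔔₁ + Xbar * 𝔔₀ * X) + ((Xbar * 𝔔₁ + Xbar * 𝔔₀ * X) + (𝔔₂ + 𝔔₁ * X + (𝔔₁ * X + 𝔔₀ * (X * X)))) = 𝔔'₂)
    -- (T-β-4): `j1` DISCHARGED (`torus_j1`); order 2 of the intertwining and the unimodularity of the parameter transport stay letters, at `c • C₁(λ)`
    (j2 : X * X * fromCols D₂ D₁ + (2 : ℝ) • (-X * W₁) + W₂ = W'₂ + (2 : ℝ) • (W'₁ * ((((Lc : ℝ) ^ (d + 1) * stepScale d Lc j)⁻¹) • C₁)) + fromCols D₂ D₁ * C₂)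
    (uC : secondVar (1 : Matrix (Res (toSite r') Lc M' ⊕ Res (toSite r) Lc (fine Lc M')) (Res (toSite r') Lc M' ⊕ Res (toSite r) Lc (fine Lc M')) ℝ)
      ((((Lc : ℝ) ^ (d + 1) * stepScale d Lc j)⁻¹) • C₁) C₂ = 0)
    -- the one-shot chart's (UNI)-jet letter (dead big-comb rows `NestedStepLawTransportedDeadRows`, or `TorusOneShotFPExponential.torus_uP_exp`), at the
    -- closed-form `W′₁`; dead rows of the nested chart: the small comb rows, and the order-2 coarse comb row of the average (`t1` DISCHARGED)
    (uP' : secondVar (P * fromCols D₂ D₁) (P * W'₁) (P * W'₂) = 0) (s1 : τ₁ * W₁ = 0) (s2 : τ₁ * W₂ = 0)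
    (t2 : τ₂ * (Q₁₂ * fromCols D₂ D₁ + (2 : ℝ) • (Q₁₁ h * W₁) + Q₁₀ * W₂) = 0)
    -- the parities of the displayed form jets (`H₀ᵀ = H₀` is a theorem, discharged inside the graded call: `PeriodisedWardOrderZero.torus_H₀_transpose`)
    (hH₁t : H₁ᵀ = -H₁) (hH₂t : H₂ᵀ = H₂)
    -- the GRADED second-order composite Ward TABLE IDENTITIES (δ-constrained: `𝔎 = H`; the door's one-sided graded shapes, `W₀ := [D₂ | D₁]`), read at
    -- `Y₀ = 0`; orders 1 and 2 only (order 0 `a0` DISCHARGED: `PeriodisedWardOrderZero.torus_a0_letter`); NO transposed rows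
    (a1 : H₁ * fromCols D₂ D₁ + H₀ * W₁ = 𝔔₀ᵀ * Y₁)
    (a2 : H₂ * fromCols D₂ D₁ + (2 : ℝ) • (H₁ * W₁) + H₀ * W₂ = -((2 : ℝ) • (𝔔₁ᵀ * Y₁)) + 𝔔₀ᵀ * Y₂)
    -- the insertion-table covariance TABLE IDENTITIES and the coarse covariance identities (order 0 discharged in p316503)
    -- order 2 only (order 1 `c1 d1` DISCHARGED: p314580, `PeriodisedCoarseWardContact`)
    (c2 : Q₁₂ * fromCols D₂ D₁ + (2 : ℝ) • (Q₁₁ h * W₁) + Q₁₀ * W₂ = fromCols Db₂ 0)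
    (d2 : Q₂₂ * Dbar + (2 : ℝ) • (Q₂₁ h * Db₁) + Q₂₀ * Db₂ = 0)
    -- block namings and the coarse non-degeneracy
    {Γ : Matrix (↥(pbox (fine Lc M')) × Fin (d + 1)) (↥(pbox (fine Lc M')) × Fin (d + 1)) ℝ}
    {I : Matrix (↥(pbox (fine Lc M')) × Fin (d + 1)) ((↥(pbox M') × Fin (d + 1)) ⊕ Res (toSite r) Lc (fine Lc M')) ℝ}
    {L : Matrix ((↥(pbox M') × Fin (d + 1)) ⊕ Res (toSite r) Lc (fine Lc M')) (↥(pbox (fine Lc M')) × Fin (d + 1)) ℝ}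
    {S : Matrix ((↥(pbox M') × Fin (d + 1)) ⊕ Res (toSite r) Lc (fine Lc M')) ((↥(pbox M') × Fin (d + 1)) ⊕ Res (toSite r) Lc (fine Lc M')) ℝ}
    {B : Matrix ((↥(pbox M') × Fin (d + 1)) ⊕ Res (toSite r) Lc (fine Lc M')) (↥(pbox (fine Lc M')) × Fin (d + 1)) ℝ}
    (hΓ : flucCov H₀ (fromRows Q₁₀ τ₁) = Γ) (hI : minOp H₀ (fromRows Q₁₀ τ₁) = I) (hL : minOpL H₀ (fromRows Q₁₀ τ₁) = L) (hS : effForm H₀ (fromRows Q₁₀ τ₁) = S)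
    (hB : fromRows (Q₁₁ h) (0 : Matrix (Res (toSite r) Lc (fine Lc M')) (↥(pbox (fine Lc M')) × Fin (d + 1)) ℝ) = B) :
    secondVar (kkt H₀ (fromRows 𝔔₀ P))
        (fromBlocks H'₁ (-(fromRows 𝔔'₁ (0 : Matrix (Res (toSite r') Lc M' ⊕ Res (toSite r) Lc (fine Lc M')) (↥(pbox (fine Lc M')) × Fin (d + 1)) ℝ))ᵀ)
          (fromRows 𝔔'₁ (0 : Matrix (Res (toSite r') Lc M' ⊕ Res (toSite r) Lc (fine Lc M')) (↥(pbox (fine Lc M')) × Fin (d + 1)) ℝ)) 0)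
        (kkt H'₂ (fromRows 𝔔'₂ (0 : Matrix (Res (toSite r') Lc M' ⊕ Res (toSite r) Lc (fine Lc M')) (↥(pbox (fine Lc M')) × Fin (d + 1)) ℝ)))
      = secondVar (kkt H₀ (fromRows Q₁₀ τ₁)) (fromBlocks H₁ (-Bᵀ) B 0)
            (kkt H₂ (fromRows Q₁₂ (0 : Matrix (Res (toSite r) Lc (fine Lc M')) (↥(pbox (fine Lc M')) × Fin (d + 1)) ℝ)))
        + secondVar
            (kkt S.toBlocks₁₁ (fromRows Q₂₀ τ₂))
            (fromBlocks ((L * H₁ - S * B) * I + L * Bᵀ * S).toBlocks₁₁ (-(fromRows (Q₂₁ h) (0 : Matrix (Res (toSite r') Lc M') (↥(pbox M') × Fin (d + 1)) ℝ))ᵀ)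
              (fromRows (Q₂₁ h) (0 : Matrix (Res (toSite r') Lc M') (↥(pbox M') × Fin (d + 1)) ℝ)) 0)
            (kkt (((-((L * H₁ - S * B) * Γ - L * Bᵀ * L) * H₁ + L * H₂
                      - (((L * H₁ - S * B) * I + L * Bᵀ * S) * B
                          + S * fromRows Q₁₂ (0 : Matrix (Res (toSite r) Lc (fine Lc M')) (↥(pbox (fine Lc M')) × Fin (d + 1)) ℝ))) * I
                    + (L * H₁ - S * B) * (-((Γ * H₁ + I * B) * I + Γ * Bᵀ * S)))
                  - ((-((L * H₁ - S * B) * Γ - L * Bᵀ * L) * (-Bᵀ)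
                        + L * (fromRows Q₁₂ (0 : Matrix (Res (toSite r) Lc (fine Lc M')) (↥(pbox (fine Lc M')) × Fin (d + 1)) ℝ))ᵀ) * S
                      + L * (-Bᵀ) * ((L * H₁ - S * B) * I + L * Bᵀ * S))).toBlocks₁₁
              (fromRows Q₂₂ (0 : Matrix (Res (toSite r') Lc M') (↥(pbox M') × Fin (d + 1)) ℝ))) := by
  subst hX hXbar hW₁ hDb₁
  -- (T-β-1) `q1`: the conjugated first composite averaging word IS the composite insertion jet along `h + Dλ` (leaf-02 `PeriodisedCompositeIndexWard`)
  have q1 := torus_q1_letter M' hr hr' hM' j h lam pμ' mμ' hQ₁₀ hQ₂₀ Q₁₁ hQ₁₁ Q₂₁ hQ₂₁ h𝔔₀ h𝔔₁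
  rw [h𝔔'₁] at q1
  exact secondVar_oneShot_nestedStepLaw_torus_transported_graded M' hr hr' hM' j pμ' mμ' hfμ' hcoarse' hH₀ hQ₁₀ hτ₁ hτ₂ hD₁ hD₂ hDbar hP H₁ H₂ hQ₂₀
    (Q₁₁ h) Q₁₂ (Q₂₁ h) Q₂₂ _ W₂ _ Db₂ 0 Y₁ Y₂ _ _ W'₁ W'₂ ((((Lc : ℝ) ^ (d + 1) * stepScale d Lc j)⁻¹) • C₁) C₂ h𝔔₀ h𝔔₁ h𝔔₂
    k1 k2 q1 q2
    -- `j1` BY TERM: p318378's summed generator jet in closed form (leaf-06 `weightedJet_eq`), then leaf-06's `torus_j1` at the record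
    (torus_j1 M' lam (((Lc : ℝ) ^ (d + 1) * stepScale d Lc j)⁻¹) h hD₁ hD₂ hC₁ rfl
      (weightedJet_eq M' (((Lc : ℝ) ^ (d + 1) * stepScale d Lc j)⁻¹) h
        (fun (b : ↥(pbox (fine Lc M')) × Fin (d + 1)) (e : Res (toSite r') Lc M' ⊕ Res (toSite r) Lc (fine Lc M')) =>
          Sum.elim (fun t : Res (toSite r') Lc M' => tdelta M' (quo Lc ((b.1 : Site (d + 1)) + unitVec b.2)) t.1)
            (fun s : Res (toSite r) Lc (fine Lc M') => tdelta (fine Lc M') ((b.1 : Site (d + 1)) + unitVec b.2) s.1) e))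
      hW'₁)
    j2 uC uP' s1 s2
    -- `t1` BY TERM (leaf-02 `NestedStepLawTorusInstanceRows`): the nested chart's direction is average-coarse-comb-dead
    (torus_t1_of_average_dead M' hr j h hQ₁₀ hD₁ hD₂ hτ₂ (hQ₁₁ h) rfl hdead) t2 hH₁t hH₂t
    -- `a0` BY TERM at `Y₀ := 0` (leaf-02 `PeriodisedWardOrderZero`); the graded `a1 a2` read at `Y₀ = 0`
    (torus_a0_letter M' hr j hH₀ hD₁ hD₂ 𝔔₀) (by rw [Matrix.mul_zero, neg_zero, zero_add]; exact a1) (by rw [Matrix.mul_zero, zero_add]; exact a2)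
    -- `c1`, `d1` BY TERM (leaf-02 p314580, `PeriodisedCoarseWardContact`)
    (by rw [hQ₁₁ h]; exact torus_c1_vhSAt_weighted M' hr j h hQ₁₀ hD₁ hD₂) c2
    (by rw [hQ₂₁ h]; exact torus_d1_vhSAt_weighted M' hr' hM' j pμ' mμ' hQ₂₀ hDbar Q₁₀ h) d2 hΓ hI hL hS hB

end Summit.QuantumFields.BalabanUV.Beta.FP.NestedStepLawTorusTransportedRowsGraded

end
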